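import Summits.BirchSwinnertonDyer.BirchSwinnertonDyer.Theorems.PrintX9MuPartOfPrintCGOfStubs
import Summits.BirchSwinnertonDyer.BirchSwinnertonDyer.Theorems.PrintX10bStubAExactAtP
import Summits.BirchSwinnertonDyer.BirchSwinnertonDyer.Theorems.PrintX9MuPartStubH5bAtSZeroPClosed
import Summits.BirchSwinnertonDyer.BirchSwinnertonDyer.Theorems.PrintX10bStubReadoutSelmer
import Summits.BirchSwinnertonDyer.BirchSwinnertonDyer.Theorems.PrintX10bReadoutIndexOfLocalClauses
import Summits.BirchSwinnertonDyer.BirchSwinnertonDyer.Theorems.PrintX10bStubReadoutLocalOff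
import Summits.BirchSwinnertonDyer.BirchSwinnertonDyer.Theorems.PrintX10bStubReadoutLocalIndexPClosed
import Summits.BirchSwinnertonDyer.BirchSwinnertonDyer.Theorems.PrintX10bStubReadoutLocalIndexBad
import Summits.BirchSwinnertonDyer.BirchSwinnertonDyer.Theses.PrintX10b
import HarnessLib

/-!
# The shared deciding μ-crux `MuInequalityCoherentPairOfPrintCG` (stmt-BirchSwinnertonDyer-23428) — CLOSED, rows 9 and 10

Line `spec_witnesses` (skeleton v9.2, μ-LEAD `bsd-line-x9-p1` g4; `--workitem` stmt-BirchSwinnertonDyer-23428).  THEOREMS ONLY.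

The round-3 μ-crux of the print routes `PrintX9` / `PrintX10b` (plan g12):
`MuInequalityCoherentPairOfPrintCG := HowardDVRKolyvaginBound → CGLSHeegnerKolyvaginSystem → CoatesGreenbergKummerImage →
HeegnerMuPartStabilized.MuPartStabilizedCoherentPair` — GIVEN, BY NAME, Howard 2004 Thm. 1.6.1 (F-161), Castella–Grossi–Lee–Skinner
2022 Thm. 4.1.1 with Rem. 4.1.4 (F-411) and Greenberg LNM 1716 Prop. 2.4 (CG), the L∃ letter holds: on every μ-frame (CGLS §3.2/§4.1
hypotheses, `¬CM`, `irr_ℚ`/`irr_K`, MZ26 scalars, (Heeg), `p ∣ h_K`) there are a stabilised Heegner datum and a coherent Howard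
family whose μ/characteristic-ideal inequality at the Eisenstein primes `𝔮_m = (T^m + p)` holds m-UNIFORMLY — the specialisation of
the Λ-adic Heegner Kolyvagin system to Howard's Eisenstein DVR settings `S_m` of `E_K` (H.0–H.5, `LargePrimes`, the pushed-forward
Kolyvagin system with NON-ZERO bottom class = the compact control image of `κ_∞`) and the m-UNIFORM control of the Selmer pair up
`K_∞/K` at `p ∣ h_K`, which is BEYOND CITABLE PRINT (REF-118).

This file is the last line of the reduction certificate `HeegnerMuPartOfPrintCG.muInequalityCoherentPairOfPrintCG_of_stubs`
(p675097): its four hypotheses are the registered stubs of skeleton v8/v9, each now a KERNEL THEOREM landed BY NAME by the cell's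
width lineages — `HeegnerMuPartH4AtS.stub_exactAtP` (p678255: (Exact) at `v ∣ p`, bsd-line-x10b-p1 LEAD g9 over (EXACT-REP)
x9-p1-w2 g8 and (ANN-SAT) x9-p1-w4 g8/g9), `HeegnerMuPartH5bAtS.stub_h5bAtSZeroP` (p676084: H.5(b) at `v ∣ p`, anomalous places
included, x10b-p1-w8 g3 over x9-p1-w3 g6's road U), `HeegnerMuPartControlGlue.stub_readoutSelmer` (p674243: (B4), x10b-p2 LEAD,
Greenberg Prop. 2.4 at `w ∣ p`), and `HeegnerMuPartControlGlue.readoutIndex_of_localClauses` (p675427, x10b-p1-w2 g11) fed with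
`stub_readoutLocalOff` (p676384, x9-p2 g6), `stub_readoutLocalIndexP` (p679487, x10b-p1-w7 g3 + x10b-p1-w6 g4) and
`stub_readoutLocalIndexBad` (p676090, x10b-p2 LEAD g8) — the m-UNIFORM index bound (B5).  Behind them: D1's Eisenstein DVR
setting and `SatisfiesH` chain (bsd-line-x10b-p1 LEADs g5–g9, `HeegnerMuPartStubA.howardInputs_of_clauses` p673958), the
KS-LINK (p666139), the Poitou–Tate kernel theorem (`InputsPoitouTateSelmer`), the compact/discrete control turnkeys (p660971,
p669215, p670216), the cyclic-port engine (p644084), lit's (W9) Howard 2004 typing and the three print leaves.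
HONEST FRAMING: the three leaves F-161 / F-411 / CG are HYPOTHESES of the crux text (statement-only Literature facts, policed
REF-131/132, REF-136/137, REF-138); no summit statement is proved; BSD is NOT proved by this file or by anything it imports.

References: [Howard2004HeegnerKolyvagin] Thm. 1.6.1, §1.3, §2.2–§2.3, Prop. 2.2.8, proof of Thm. 2.2.10;
[CastellaGrossiLeeSkinner2022] Thm. 4.1.1, Rem. 4.1.4, §3.2, §3.4; [GreenbergLNM1716] Prop. 2.4; [MastellaZerman2026] Thm. 2.40;
[MilneADT2006] I Thm. 4.10.
-/

set_option linter.dupNamespace false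
set_option autoImplicit false

namespace Summit.BirchSwinnertonDyer.BirchSwinnertonDyer.Theorems.HeegnerMuPartOfPrintCGClosed

open Summit.BirchSwinnertonDyer.BirchSwinnertonDyer.Theorems

/-- **The m-uniform index bound (B5) `Stmt.readoutIndex` of the discrete control**, assembled from its three place-wise clauses
(off `S` p676384, at `v ∣ p` p679487, at `v ∣ N` p676090) by x10b-p1-w2 g11's `readoutIndex_of_localClauses` (p675427).
[cite: Howard2004HeegnerKolyvagin, Prop. 2.2.8 (second map) and proof of Thm. 2.2.10] -/
theorem readoutIndex_holds : HeegnerMuPartControlGlue.Stmt.readoutIndex :=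
  HeegnerMuPartControlGlue.readoutIndex_of_localClauses HeegnerMuPartControlGlue.stub_readoutLocalOff
    HeegnerMuPartControlGlue.stub_readoutLocalIndexP HeegnerMuPartControlGlue.stub_readoutLocalIndexBad

/-- **ROW 9 — the shared deciding μ-crux BY NAME**: `Theses.PrintX9.MuInequalityCoherentPairOfPrintCG`
(stmt-BirchSwinnertonDyer-23428) from its four registered stubs, all kernel theorems.
[cite: Howard2004HeegnerKolyvagin, Thm. 1.6.1 and proof of Thm. 2.2.10] [cite: CastellaGrossiLeeSkinner2022, Thm. 4.1.1, Rem. 4.1.4]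
[cite: GreenbergLNM1716, Prop. 2.4] -/
theorem muInequalityCoherentPairOfPrintCG_holds :
    Summit.BirchSwinnertonDyer.BirchSwinnertonDyer.Theses.PrintX9.MuInequalityCoherentPairOfPrintCG :=
  HeegnerMuPartOfPrintCG.muInequalityCoherentPairOfPrintCG_of_stubs HeegnerMuPartH4AtS.stub_exactAtP
    HeegnerMuPartH5bAtS.stub_h5bAtSZeroP HeegnerMuPartControlGlue.stub_readoutSelmer readoutIndex_holds

/-- **ROW 10 twin — the same item over `Theses.PrintX10b`** (identical text `HowardDVRKolyvaginBound → CGLSHeegnerKolyvaginSystem →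
CoatesGreenbergKummerImage → HeegnerMuPartStabilized.MuPartStabilizedCoherentPair`; each leaf the same Literature constant). -/
theorem muInequalityCoherentPairOfPrintCG_holds_X10b :
    Summit.BirchSwinnertonDyer.BirchSwinnertonDyer.Theses.PrintX10b.MuInequalityCoherentPairOfPrintCG :=
  muInequalityCoherentPairOfPrintCG_holds

/-- **The L∃ letter given the three print leaves** (route-free form, for downstream consumers that do not import a route file):
Howard Thm. 1.6.1 ⟹ CGLS Thm. 4.1.1 ⟹ Greenberg Prop. 2.4 ⟹ `HeegnerMuPartStabilized.MuPartStabilizedCoherentPair`. -/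
theorem muPartStabilizedCoherentPair_of_leaves :
    Literature.NumberTheory.GaloisCohomology.Howard2004.thm161_dvrKolyvaginBound →
      Literature.NumberTheory.EllipticCurves.CastellaGrossiLeeSkinner2022.thm411_exists_kolyvaginSystem_one_ne_zero →
        Literature.NumberTheory.EllipticCurves.Greenberg1999.imKummer_eq_strictCondition_goodOrdinary_numberField →
          HeegnerMuPartStabilized.MuPartStabilizedCoherentPair :=
  muInequalityCoherentPairOfPrintCG_holds

end Summit.BirchSwinnertonDyer.BirchSwinnertonDyer.Theorems.HeegnerMuPartOfPrintCGClosed
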